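import Summits.KontsevichZagierPeriods.KontsevichZagierPeriods.Theorems.ValuedFieldSpecialisationCTConstructionBlowupMap
import Summits.KontsevichZagierPeriods.KontsevichZagierPeriods.Theorems.ValuedFieldSpecialisationCTConstructionBlowupShear
import Summits.KontsevichZagierPeriods.KontsevichZagierPeriods.Theorems.ValuedFieldSpecialisationCTConstructionBlowupDominated
import Summits.KontsevichZagierPeriods.KontsevichZagierPeriods.Theorems.ValuedFieldSpecialisationCTConstructionWeightMap
import Summits.KontsevichZagierPeriods.KontsevichZagierPeriods.Theorems.ValuedFieldSpecialisationCTConstructionCylinderMoments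

/-!
# Route ValuedFieldSpecialisation — crux `CTConstruction`: the operator `T = 2β − 1` on fibred relations and dominated pairs

Helper toward crux stmt-KontsevichZagierPeriods-3495 (`CTConstruction`), line `registered`, reshape r4
(blow-up elimination of the log block; lead file, the analogue of cycle 3's `…ThetaPlumbing`). Let `Tβ`
be ANY map on the generators of `KZ.FormalRep` killing dimension `0` and sending each family
`⟨n + 1, ρ⟩` to the class of some representation with the data of its weight-slab BLOW-UP
(`stub_exists_blowup`), `β = FreeAbelianGroup.lift Tβ`, and `T x = 2 • β x − x`. Then:

* `T` and its iterates map `KZ.fibredRelations` into itself (`stub_blowupMap_mem_fibredRelations`) and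
  are additive (`blowupT_iterate_map_sub/sum/zsmul`);
* on the subgroup of `FormalRep × FormalRep` generated by the DOMINATED PAIRS `([S], [r₀])`
  (`KZ.IsDominatedFamily S r₀ g`): `β [S] ≡ [β₁ S]` modulo fibred relations for the sheared blow-up
  `β₁ S` (`stub_blowup_shear`), which is dominated with special fibre the `s'`-weighted cylinder `r₁`
  of `r₀` (`stub_isDominatedFamily_blowup`, `stub_exists_weightRestrict`) and `2 • [r₁] − [r₀] ∈ relations`
  (`stub_cylinder_weighted_total`). Hence (`blowup_closure_dominatedPairs`) every `(G, y)` in the pair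
  subgroup has a `(G', y')` in it with `β G ≡ G'` and `2 • y' ≡ y`; so `T G ≡ 2 • G' − G` with special
  fibre `2 • y' − y ∈ relations`: **`T` KILLS SPECIAL FIBRES** (`blowupT_closure_dominatedPairs`), and so
  do all `T^[n]`, `n ≥ 1` (`blowupT_iterate_closure_dominatedPairs`).

Sources: M. Kontsevich, D. Zagier, *Periods* (2001), §1.2; the blow-up calculus is this route's.
No new definitions.
-/

noncomputable section

namespace Summit.KontsevichZagierPeriods.ValuedFieldSpecialisation

open MeasureTheory Set Filter
open scoped Topology
open Literature.NumberTheory.Transcendental Literature.NumberTheory.Transcendental.KZ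

section Plumbing

variable {Tβ : (Σ n, IntegralRep n) → FormalRep}
  (hT0 : ∀ ρ : IntegralRep 0, Tβ ⟨0, ρ⟩ = 0)
  (hT : ∀ (n : ℕ) (ρ : IntegralRep (n + 1)), ∃ ρ' : IntegralRep (n + 1 + 1), Tβ ⟨n + 1, ρ⟩ = of ρ' ∧
    ρ'.domain = {z | 0 < z 1 ∧ z 1 < z 0 ∧ z 0 < 1 ∧ (fun i : Fin (n + 1) => z i.succ) ∈ ρ.domain} ∧
    ρ'.integrand = fun z => z 1 / z 0 ^ 2 * ρ.integrand (fun i : Fin (n + 1) => z i.succ))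

/-! ## `T = 2β − 1` and its iterates: additivity, fibred relations -/

/-- `T (a − b) = T a − T b` for `T x = 2 • β x − x`. [folklore] -/
theorem blowupT_map_sub (a b : FormalRep) :
    (2 • FreeAbelianGroup.lift Tβ (a - b) - (a - b)) =
      (2 • FreeAbelianGroup.lift Tβ a - a) - (2 • FreeAbelianGroup.lift Tβ b - b) := by
  rw [map_sub, smul_sub]; abel

/-- `T^[n] (a − b) = T^[n] a − T^[n] b`. [folklore] -/
theorem blowupT_iterate_map_sub (n : ℕ) (a b : FormalRep) :
    (fun x => 2 • FreeAbelianGroup.lift Tβ x - x)^[n] (a - b) =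
      (fun x => 2 • FreeAbelianGroup.lift Tβ x - x)^[n] a -
        (fun x => 2 • FreeAbelianGroup.lift Tβ x - x)^[n] b := by
  induction n generalizing a b with
  | zero => rfl
  | succ n ih =>
    simp only [Function.iterate_succ, Function.comp_apply]
    rw [blowupT_map_sub, ih]

/-- `T^[n] 0 = 0`. [folklore] -/
theorem blowupT_iterate_zero (n : ℕ) :
    (fun x => 2 • FreeAbelianGroup.lift Tβ x - x)^[n] (0 : FormalRep) = 0 := by
  have h := blowupT_iterate_map_sub (Tβ := Tβ) n 0 0
  rwa [sub_self, sub_self] at h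

/-- `T^[n] (a + b) = T^[n] a + T^[n] b`. [folklore] -/
theorem blowupT_iterate_map_add (n : ℕ) (a b : FormalRep) :
    (fun x => 2 • FreeAbelianGroup.lift Tβ x - x)^[n] (a + b) =
      (fun x => 2 • FreeAbelianGroup.lift Tβ x - x)^[n] a +
        (fun x => 2 • FreeAbelianGroup.lift Tβ x - x)^[n] b := by
  have h := blowupT_iterate_map_sub (Tβ := Tβ) n (a + b) b
  rw [add_sub_cancel_right] at h
  rw [← sub_eq_iff_eq_add, h]

/-- `T^[n]` is additive over finite sums. [folklore] -/
theorem blowupT_iterate_map_sum (n : ℕ) {ι : Type*} (s : Finset ι) (g : ι → FormalRep) :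
    (fun x => 2 • FreeAbelianGroup.lift Tβ x - x)^[n] (∑ i ∈ s, g i) =
      ∑ i ∈ s, (fun x => 2 • FreeAbelianGroup.lift Tβ x - x)^[n] (g i) := by
  classical
  induction s using Finset.induction_on with
  | empty => simp [blowupT_iterate_zero]
  | insert a s ha ih => rw [Finset.sum_insert ha, Finset.sum_insert ha, blowupT_iterate_map_add, ih]

/-- `T^[n] (m • a) = m • T^[n] a` for integers `m`. [folklore] -/
theorem blowupT_iterate_map_zsmul (n : ℕ) (m : ℤ) (a : FormalRep) :
    (fun x => 2 • FreeAbelianGroup.lift Tβ x - x)^[n] (m • a) =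
      m • (fun x => 2 • FreeAbelianGroup.lift Tβ x - x)^[n] a := by
  induction m using Int.induction_on with
  | zero => rw [zero_smul, zero_smul, blowupT_iterate_zero]
  | succ k ih => rw [add_smul, one_smul, blowupT_iterate_map_add, ih, add_smul, one_smul]
  | pred k ih => rw [sub_smul, one_smul, blowupT_iterate_map_sub, ih, sub_smul, one_smul]

/-- `T^[n] (m • a) = m • T^[n] a` for naturals `m`. [folklore] -/
theorem blowupT_iterate_map_nsmul (n : ℕ) (m : ℕ) (a : FormalRep) :
    (fun x => 2 • FreeAbelianGroup.lift Tβ x - x)^[n] (m • a) =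
      m • (fun x => 2 • FreeAbelianGroup.lift Tβ x - x)^[n] a := by
  have h := blowupT_iterate_map_zsmul (Tβ := Tβ) n (m : ℤ) a
  rwa [natCast_zsmul, natCast_zsmul] at h

include hT0 hT in
/-- **`β` preserves fibred relations** (`stub_blowupMap_mem_fibredRelations`). [folklore] -/
theorem blowup_mem_fibredRelations {c : FormalRep} (hc : c ∈ fibredRelations) :
    FreeAbelianGroup.lift Tβ c ∈ fibredRelations :=
  stub_blowupMap_mem_fibredRelations Tβ hT0 hT c hc

include hT0 hT in
/-- **`T = 2β − 1` preserves fibred relations.** [folklore] -/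
theorem blowupT_mem_fibredRelations {c : FormalRep} (hc : c ∈ fibredRelations) :
    2 • FreeAbelianGroup.lift Tβ c - c ∈ fibredRelations :=
  fibredRelations.sub_mem (fibredRelations.nsmul_mem (blowup_mem_fibredRelations hT0 hT hc) 2) hc

include hT0 hT in
/-- **`T^[n]` preserves fibred relations.** [folklore] -/
theorem blowupT_iterate_mem_fibredRelations (n : ℕ) {c : FormalRep} (hc : c ∈ fibredRelations) :
    (fun x => 2 • FreeAbelianGroup.lift Tβ x - x)^[n] c ∈ fibredRelations := by
  induction n with
  | zero => exact hc
  | succ n ih =>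
    rw [Function.iterate_succ_apply']
    exact blowupT_mem_fibredRelations hT0 hT ih

include hT0 hT in
/-- `T^[n]` respects congruence modulo fibred relations. [folklore] -/
theorem blowupT_iterate_sub_mem_fibredRelations (n : ℕ) {a b : FormalRep} (h : a - b ∈ fibredRelations) :
    (fun x => 2 • FreeAbelianGroup.lift Tβ x - x)^[n] a -
      (fun x => 2 • FreeAbelianGroup.lift Tβ x - x)^[n] b ∈ fibredRelations := by
  rw [← blowupT_iterate_map_sub]
  exact blowupT_iterate_mem_fibredRelations hT0 hT n h

/-! ## `β` and `T` on dominated pairs -/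

include hT in
/-- **`β` on the dominated-pair subgroup.** For `(G, y)` in the subgroup generated by the dominated
pairs there is `(G', y')` in it with `β G − G' ∈ fibredRelations` and `2 • y' − y ∈ relations`: on a
generator `([S], [r₀])`, `β [S] = [βʷ S] ≡ [β₁ S]` (`stub_blowup_shear`), `(β₁ S, r₁)` is a dominated pair
for the `s'`-weighted cylinder `r₁` of `r₀` (`stub_isDominatedFamily_blowup`, `stub_exists_weightRestrict`)
and `2 • [r₁] − [r₀] ∈ relations` (`stub_cylinder_weighted_total`); then closure induction.
[Kontsevich–Zagier 2001, §1.2] [folklore] -/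
theorem blowup_closure_dominatedPairs {G y : FormalRep}
    (h : (G, y) ∈ AddSubgroup.closure {v : Literature.NumberTheory.Transcendental.KZ.FormalRep × Literature.NumberTheory.Transcendental.KZ.FormalRep | ∃ (n : ℕ) (S : Literature.NumberTheory.Transcendental.KZ.IntegralRep (n + 1)) (r₀ g : Literature.NumberTheory.Transcendental.KZ.IntegralRep n), Literature.NumberTheory.Transcendental.KZ.IsDominatedFamily S r₀ g ∧ v = (Literature.NumberTheory.Transcendental.KZ.of S, Literature.NumberTheory.Transcendental.KZ.of r₀)}) :
    ∃ G' y' : FormalRep, FreeAbelianGroup.lift Tβ G - G' ∈ fibredRelations ∧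
      (G', y') ∈ AddSubgroup.closure {v : Literature.NumberTheory.Transcendental.KZ.FormalRep × Literature.NumberTheory.Transcendental.KZ.FormalRep | ∃ (n : ℕ) (S : Literature.NumberTheory.Transcendental.KZ.IntegralRep (n + 1)) (r₀ g : Literature.NumberTheory.Transcendental.KZ.IntegralRep n), Literature.NumberTheory.Transcendental.KZ.IsDominatedFamily S r₀ g ∧ v = (Literature.NumberTheory.Transcendental.KZ.of S, Literature.NumberTheory.Transcendental.KZ.of r₀)} ∧
      2 • y' - y ∈ relations := by
  -- closure induction on pairs, with the statement generalised to the pair `v = (G, y)`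
  suffices H : ∀ v ∈ AddSubgroup.closure {v : Literature.NumberTheory.Transcendental.KZ.FormalRep × Literature.NumberTheory.Transcendental.KZ.FormalRep | ∃ (n : ℕ) (S : Literature.NumberTheory.Transcendental.KZ.IntegralRep (n + 1)) (r₀ g : Literature.NumberTheory.Transcendental.KZ.IntegralRep n), Literature.NumberTheory.Transcendental.KZ.IsDominatedFamily S r₀ g ∧ v = (Literature.NumberTheory.Transcendental.KZ.of S, Literature.NumberTheory.Transcendental.KZ.of r₀)},
      ∃ G' y' : FormalRep, FreeAbelianGroup.lift Tβ v.1 - G' ∈ fibredRelations ∧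
        (G', y') ∈ AddSubgroup.closure {v : Literature.NumberTheory.Transcendental.KZ.FormalRep × Literature.NumberTheory.Transcendental.KZ.FormalRep | ∃ (n : ℕ) (S : Literature.NumberTheory.Transcendental.KZ.IntegralRep (n + 1)) (r₀ g : Literature.NumberTheory.Transcendental.KZ.IntegralRep n), Literature.NumberTheory.Transcendental.KZ.IsDominatedFamily S r₀ g ∧ v = (Literature.NumberTheory.Transcendental.KZ.of S, Literature.NumberTheory.Transcendental.KZ.of r₀)} ∧
        2 • y' - v.2 ∈ relations from H _ h
  intro v hv
  refine AddSubgroup.closure_induction (fun v hv => ?_) ?_ (fun v w _ _ hv hw => ?_) (fun v _ hv => ?_) hv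
  · obtain ⟨n, S, r₀, g, hdom, rfl⟩ := hv
    obtain ⟨S₀, hS₀, hS₀d, hS₀i⟩ := hT n S
    obtain ⟨S₁, hS₁d, hS₁i, h01⟩ := stub_blowup_shear n S S₀ hS₀d hS₀i
    obtain ⟨r₁, hr₁d, hr₁i⟩ := stub_exists_weightRestrict 1 n r₀.cylinder
    have hdom₁ : IsDominatedFamily S₁ r₁ g.cylinder :=
      stub_isDominatedFamily_blowup n S r₀ g S₁ r₁ hdom hS₁d hS₁i hr₁d hr₁i
    refine ⟨of S₁, of r₁, ?_, AddSubgroup.subset_closure ⟨_, S₁, r₁, g.cylinder, hdom₁, rfl⟩,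
      stub_cylinder_weighted_total n r₀ r₁ hr₁d hr₁i⟩
    dsimp only
    rw [dilate_lift_of, hS₀]
    exact h01
  · exact ⟨0, 0, by simp [fibredRelations.zero_mem], AddSubgroup.zero_mem _, by simp [relations.zero_mem]⟩
  · obtain ⟨G₁, y₁, h₁, h₁', h₁''⟩ := hv
    obtain ⟨G₂, y₂, h₂, h₂', h₂''⟩ := hw
    refine ⟨G₁ + G₂, y₁ + y₂, ?_, ?_, ?_⟩
    · rw [Prod.fst_add, map_add]
      convert fibredRelations.add_mem h₁ h₂ using 1
      abel
    · rw [← Prod.mk_add_mk]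
      exact AddSubgroup.add_mem _ h₁' h₂'
    · rw [Prod.snd_add]
      convert relations.add_mem h₁'' h₂'' using 1
      rw [smul_add]
      abel
  · obtain ⟨G₁, y₁, h₁, h₁', h₁''⟩ := hv
    refine ⟨-G₁, -y₁, ?_, ?_, ?_⟩
    · rw [Prod.fst_neg, map_neg]
      convert fibredRelations.neg_mem h₁ using 1
      abel
    · rw [← Prod.neg_mk]
      exact AddSubgroup.neg_mem _ h₁'
    · rw [Prod.snd_neg]
      convert relations.neg_mem h₁'' using 1
      rw [smul_neg]
      abel

include hT in
/-- **`T = 2β − 1` kills special fibres.** For `(G, y)` in the dominated-pair subgroup there is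
`(G₁, y₁)` in it with `T G − G₁ ∈ fibredRelations` and `y₁ ∈ relations`
(`G₁ = 2 • G' − G`, `y₁ = 2 • y' − y`). [folklore] -/
theorem blowupT_closure_dominatedPairs {G y : FormalRep}
    (h : (G, y) ∈ AddSubgroup.closure {v : Literature.NumberTheory.Transcendental.KZ.FormalRep × Literature.NumberTheory.Transcendental.KZ.FormalRep | ∃ (n : ℕ) (S : Literature.NumberTheory.Transcendental.KZ.IntegralRep (n + 1)) (r₀ g : Literature.NumberTheory.Transcendental.KZ.IntegralRep n), Literature.NumberTheory.Transcendental.KZ.IsDominatedFamily S r₀ g ∧ v = (Literature.NumberTheory.Transcendental.KZ.of S, Literature.NumberTheory.Transcendental.KZ.of r₀)}) :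
    ∃ G₁ y₁ : FormalRep, (2 • FreeAbelianGroup.lift Tβ G - G) - G₁ ∈ fibredRelations ∧
      (G₁, y₁) ∈ AddSubgroup.closure {v : Literature.NumberTheory.Transcendental.KZ.FormalRep × Literature.NumberTheory.Transcendental.KZ.FormalRep | ∃ (n : ℕ) (S : Literature.NumberTheory.Transcendental.KZ.IntegralRep (n + 1)) (r₀ g : Literature.NumberTheory.Transcendental.KZ.IntegralRep n), Literature.NumberTheory.Transcendental.KZ.IsDominatedFamily S r₀ g ∧ v = (Literature.NumberTheory.Transcendental.KZ.of S, Literature.NumberTheory.Transcendental.KZ.of r₀)} ∧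
      y₁ ∈ relations := by
  obtain ⟨G', y', h1, h2, h3⟩ := blowup_closure_dominatedPairs hT h
  refine ⟨2 • G' - G, 2 • y' - y, ?_, ?_, h3⟩
  · convert fibredRelations.nsmul_mem h1 2 using 1
    rw [smul_sub]
    abel
  · have hsub := AddSubgroup.sub_mem _ (AddSubgroup.nsmul_mem _ h2 2) h
    simpa using hsub

include hT0 hT in
/-- **All positive iterates of `T` kill special fibres.** For `n ≥ 1` and `(G, y)` in the dominated-pair
subgroup there is `(Gₙ, yₙ)` in it with `T^[n] G − Gₙ ∈ fibredRelations` and `yₙ ∈ relations`.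
[folklore] -/
theorem blowupT_iterate_closure_dominatedPairs (n : ℕ) (hn : 1 ≤ n) {G y : FormalRep}
    (h : (G, y) ∈ AddSubgroup.closure {v : Literature.NumberTheory.Transcendental.KZ.FormalRep × Literature.NumberTheory.Transcendental.KZ.FormalRep | ∃ (n : ℕ) (S : Literature.NumberTheory.Transcendental.KZ.IntegralRep (n + 1)) (r₀ g : Literature.NumberTheory.Transcendental.KZ.IntegralRep n), Literature.NumberTheory.Transcendental.KZ.IsDominatedFamily S r₀ g ∧ v = (Literature.NumberTheory.Transcendental.KZ.of S, Literature.NumberTheory.Transcendental.KZ.of r₀)}) :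
    ∃ Gₙ yₙ : FormalRep, (fun x => 2 • FreeAbelianGroup.lift Tβ x - x)^[n] G - Gₙ ∈ fibredRelations ∧
      (Gₙ, yₙ) ∈ AddSubgroup.closure {v : Literature.NumberTheory.Transcendental.KZ.FormalRep × Literature.NumberTheory.Transcendental.KZ.FormalRep | ∃ (n : ℕ) (S : Literature.NumberTheory.Transcendental.KZ.IntegralRep (n + 1)) (r₀ g : Literature.NumberTheory.Transcendental.KZ.IntegralRep n), Literature.NumberTheory.Transcendental.KZ.IsDominatedFamily S r₀ g ∧ v = (Literature.NumberTheory.Transcendental.KZ.of S, Literature.NumberTheory.Transcendental.KZ.of r₀)} ∧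
      yₙ ∈ relations := by
  induction n with
  | zero => exact absurd hn (by omega)
  | succ n ih =>
    rcases Nat.eq_zero_or_pos n with rfl | hpos
    · simpa using blowupT_closure_dominatedPairs hT h
    · obtain ⟨Gₙ, yₙ, h1, h2, -⟩ := ih hpos
      obtain ⟨G', y', h1', h2', h3'⟩ := blowupT_closure_dominatedPairs hT h2
      refine ⟨G', y', ?_, h2', h3'⟩
      rw [Function.iterate_succ_apply']
      have hstep : (2 • FreeAbelianGroup.lift Tβ ((fun x => 2 • FreeAbelianGroup.lift Tβ x - x)^[n] G) -
          (fun x => 2 • FreeAbelianGroup.lift Tβ x - x)^[n] G) -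
          (2 • FreeAbelianGroup.lift Tβ Gₙ - Gₙ) ∈ fibredRelations := by
        rw [← blowupT_map_sub]
        exact blowupT_mem_fibredRelations hT0 hT h1
      have := fibredRelations.add_mem hstep h1'
      convert this using 1
      abel

end Plumbing

/-- **Registered stub `stub_blowupT_plumbing`** (crux `CTConstruction`, line `registered`, reshape r4):
all positive iterates of `T = 2β − 1` kill special fibres, explicit form of
`blowupT_iterate_closure_dominatedPairs`. [folklore] -/
theorem stub_blowupT_plumbing : ∀ (Tβ : (Σ n, Literature.NumberTheory.Transcendental.KZ.IntegralRep n) → Literature.NumberTheory.Transcendental.KZ.FormalRep), (∀ ρ : Literature.NumberTheory.Transcendental.KZ.IntegralRep 0, Tβ ⟨0, ρ⟩ = 0) → (∀ (n : ℕ) (ρ : Literature.NumberTheory.Transcendental.KZ.IntegralRep (n + 1)), ∃ ρ' : Literature.NumberTheory.Transcendental.KZ.IntegralRep (n + 1 + 1), Tβ ⟨n + 1, ρ⟩ = Literature.NumberTheory.Transcendental.KZ.of ρ' ∧ ρ'.domain = {z | 0 < z 1 ∧ z 1 < z 0 ∧ z 0 < 1 ∧ (fun i : Fin (n + 1) =>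 z i.succ) ∈ ρ.domain} ∧ ρ'.integrand = fun z => z 1 / z 0 ^ 2 * ρ.integrand (fun i : Fin (n + 1) => z i.succ)) → ∀ (n : ℕ), 1 ≤ n → ∀ (G y : Literature.NumberTheory.Transcendental.KZ.FormalRep), (G, y) ∈ AddSubgroup.closure {v : Literature.NumberTheory.Transcendental.KZ.FormalRep × Literature.NumberTheory.Transcendental.KZ.FormalRep | ∃ (n : ℕ) (S : Literature.NumberTheory.Transcendental.KZ.IntegralRep (n + 1)) (r₀ g : Literature.NumberTheory.Transcendental.KZ.IntegralRep n), Literature.NumberTheory.Transcendental.KZ.IsDominatedFamily S r₀ g ∧ v = (Literature.NumberTheory.Transcendental.KZ.of S, Literature.NumberTheory.Transcendental.KZ.of r₀)} → ∃ Gₙ yₙ : Literature.NumberTheory.Transcendental.KZ.FormalRep, (fun x => 2 • FreeAbelianGroup.lift Tβ x - x)^[n] G - Gₙ ∈ Literature.NumberTheory.Transcendental.KZ.fibredRelations ∧ (Gₙ, yₙ) ∈ AddSubgroup.closure {v : Literature.NumberTheory.Transcendental.KZ.FormalRep × Literature.NumberTheory.Transcendental.KZ.FormalRep | ∃ (n :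 ℕ) (S : Literature.NumberTheory.Transcendental.KZ.IntegralRep (n + 1)) (r₀ g : Literature.NumberTheory.Transcendental.KZ.IntegralRep n), Literature.NumberTheory.Transcendental.KZ.IsDominatedFamily S r₀ g ∧ v = (Literature.NumberTheory.Transcendental.KZ.of S, Literature.NumberTheory.Transcendental.KZ.of r₀)} ∧ yₙ ∈ Literature.NumberTheory.Transcendental.KZ.relations :=
  fun _ hT0 hT n hn _ _ h => blowupT_iterate_closure_dominatedPairs hT0 hT n hn h

end Summit.KontsevichZagierPeriods.ValuedFieldSpecialisation
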